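import Mathlib
import Literature.MathematicalPhysics.QuantumManyBody.BoseEinsteinCondensation

/-!
# Bhattacharyya sandwich for the weight of a one-particle mode

Solo seat `solo-AtomisticToContinuum-blind`, conjunct `BoseEinsteinCondensation`.

Abstract measure-theoretic core of an *affinity criterion for Bose–Einstein condensation*.
Let `Ψ ≥ 0` be an amplitude on a product space `α × β` (`α` = the distinguished particle,
`β` = the remaining `N - 1` particles), `P̂ b = ∫ Ψ(y,b)² dμ(y)` the marginal density of the
rest, and `φ ≥ 0` a one-particle mode.  Writing

* `m b  = ∫ φ(y) Ψ(y,b) dμ(y)`                       (mode amplitude given the rest),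
* `f    = ∫ (m b)² dν(b)`                            (= `⟨φ, γ_Ψ φ⟩ / N`, the weight of the mode),
* `BC   = ∫ m b · (P̂ b)^{1/2} dν(b) = ∫ √( φ(y)² P̂(b) · Ψ(y,b)² ) d(μ ⊗ ν)`
          (the Bhattacharyya coefficient / Hellinger affinity between the measure `Ψ² (μ ⊗ ν)`
          and its "one-particle resampling" `(φ² μ) ⊗ (P̂ ν)`),

we prove the sandwich `BC² ≤ f · ∫∫ Ψ² ` and, when `∫ φ² ≤ 1`, `f ≤ BC`.  For a normalised
nonnegative `N`-body wave function this reads `BC² ≤ ⟨φ, γ_Ψ φ⟩/N ≤ BC`: macroscopic occupation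
of a mode is *equivalent* (up to a square) to non-vanishing Hellinger affinity between the
`|Ψ|²` point process and its one-particle resampling.  Everything here is elementary
(Cauchy–Schwarz twice); the file exists so that the criterion used on the path
"bounded Rényi-½ divergence ⇒ ground-state BEC" is kernel-checked in its exact form.
-/

open MeasureTheory
open scoped ENNReal

namespace Summit.AtomisticToContinuum.BoseEinsteinCondensation.Theorems

variable {α β : Type*} [MeasurableSpace α] [MeasurableSpace β]

/-- Cauchy–Schwarz for `lintegral` with natural-number squares:
`(∫ f g)² ≤ (∫ f²) (∫ g²)`. -/
theorem lintegral_mul_sq_le_lintegral_sq_mul (μ : Measure α) {f g : α → ℝ≥0∞}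
    (hf : AEMeasurable f μ) (hg : AEMeasurable g μ) :
    (∫⁻ y, f y * g y ∂μ) ^ 2 ≤ (∫⁻ y, f y ^ 2 ∂μ) * ∫⁻ y, g y ^ 2 ∂μ := by
  have h := ENNReal.lintegral_mul_le_Lp_mul_Lq μ Real.HolderConjugate.two_two hf hg
  simp only [Pi.mul_apply, ENNReal.rpow_two] at h
  calc (∫⁻ y, f y * g y ∂μ) ^ 2
      ≤ ((∫⁻ y, f y ^ 2 ∂μ) ^ (1 / 2 : ℝ) * (∫⁻ y, g y ^ 2 ∂μ) ^ (1 / 2 : ℝ)) ^ 2 := by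
        gcongr
    _ = (∫⁻ y, f y ^ 2 ∂μ) * ∫⁻ y, g y ^ 2 ∂μ := by
        rw [← ENNReal.mul_rpow_of_nonneg _ _ (by norm_num : (0 : ℝ) ≤ 1 / 2), ← ENNReal.rpow_two,
          ← ENNReal.rpow_mul]
        norm_num

/-- From `(∫ f g)² ≤ (∫ f²)(∫ g²)` and `∫ f² ≤ 1`: `∫ f g ≤ (∫ g²)^{1/2}`. -/
theorem lintegral_mul_le_sqrt (μ : Measure α) {f g : α → ℝ≥0∞}
    (hf : AEMeasurable f μ) (hg : AEMeasurable g μ) (hf1 : ∫⁻ y, f y ^ 2 ∂μ ≤ 1) :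
    ∫⁻ y, f y * g y ∂μ ≤ (∫⁻ y, g y ^ 2 ∂μ) ^ (1 / 2 : ℝ) := by
  have h := lintegral_mul_sq_le_lintegral_sq_mul μ hf hg
  have h' : (∫⁻ y, f y * g y ∂μ) ^ 2 ≤ ∫⁻ y, g y ^ 2 ∂μ := by
    calc (∫⁻ y, f y * g y ∂μ) ^ 2 ≤ (∫⁻ y, f y ^ 2 ∂μ) * ∫⁻ y, g y ^ 2 ∂μ := h
      _ ≤ 1 * ∫⁻ y, g y ^ 2 ∂μ := by gcongr
      _ = ∫⁻ y, g y ^ 2 ∂μ := one_mul _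
  calc ∫⁻ y, f y * g y ∂μ = ((∫⁻ y, f y * g y ∂μ) ^ 2) ^ (1 / 2 : ℝ) := by
        rw [← ENNReal.rpow_two, ← ENNReal.rpow_mul]; norm_num
    _ ≤ (∫⁻ y, g y ^ 2 ∂μ) ^ (1 / 2 : ℝ) := by gcongr

variable (μ : Measure α) (ν : Measure β)

/-- **Bhattacharyya lower bound (abstract Penrose–Onsager affinity bound).**
For a jointly measurable amplitude `Ψ ≥ 0` on `α × β` and a mode `φ ≥ 0` on `α`,
`( ∫_b m(b) P̂(b)^{1/2} dν )² ≤ ( ∫_b m(b)² dν ) · ∫_b P̂(b) dν`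
with `m(b) = ∫ φ Ψ(·,b) dμ`, `P̂(b) = ∫ Ψ(·,b)² dμ`.  For `∫∫ Ψ² = 1` the left side is the squared
Bhattacharyya coefficient of `Ψ²(μ⊗ν)` versus `(φ²μ) ⊗ (P̂ν)` and the right side is the weight
`⟨φ, γ_Ψ φ⟩/N` of the mode `φ`. -/
theorem bhattacharyya_sq_le_modeWeight_mul [SFinite μ] {Ψ : α → β → ℝ≥0∞} {φ : α → ℝ≥0∞}
    (hΨ : Measurable (Function.uncurry Ψ)) (hφ : Measurable φ) :
    (∫⁻ b, (∫⁻ y, φ y * Ψ y b ∂μ) * (∫⁻ y, Ψ y b ^ 2 ∂μ) ^ (1 / 2 : ℝ) ∂ν) ^ 2 ≤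
      (∫⁻ b, (∫⁻ y, φ y * Ψ y b ∂μ) ^ 2 ∂ν) * ∫⁻ b, ∫⁻ y, Ψ y b ^ 2 ∂μ ∂ν := by
  -- measurability of the two `b`-functions
  have hm : Measurable fun b => ∫⁻ y, φ y * Ψ y b ∂μ := by
    have : Measurable fun p : α × β => φ p.1 * Ψ p.1 p.2 := (hφ.comp measurable_fst).mul hΨ
    exact this.lintegral_prod_left'
  have hP : Measurable fun b => ∫⁻ y, Ψ y b ^ 2 ∂μ := by
    have : Measurable fun p : α × β => Ψ p.1 p.2 ^ 2 := hΨ.pow_const 2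
    exact this.lintegral_prod_left'
  have h := lintegral_mul_sq_le_lintegral_sq_mul ν hm.aemeasurable
    ((hP.pow_const (1 / 2 : ℝ)).aemeasurable)
  refine h.trans (le_of_eq ?_)
  congr 1
  refine lintegral_congr fun b => ?_
  rw [← ENNReal.rpow_two, ← ENNReal.rpow_mul]
  norm_num

/-- **Bhattacharyya upper bound.** If moreover `∫ φ² dμ ≤ 1` then
`∫_b m(b)² dν ≤ ∫_b m(b) P̂(b)^{1/2} dν`, i.e. `⟨φ, γ_Ψ φ⟩/N ≤ BC`. -/
theorem modeWeight_le_bhattacharyya {Ψ : α → β → ℝ≥0∞} {φ : α → ℝ≥0∞}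
    (hΨ : Measurable (Function.uncurry Ψ)) (hφ : Measurable φ) (hφ1 : ∫⁻ y, φ y ^ 2 ∂μ ≤ 1) :
    ∫⁻ b, (∫⁻ y, φ y * Ψ y b ∂μ) ^ 2 ∂ν ≤
      ∫⁻ b, (∫⁻ y, φ y * Ψ y b ∂μ) * (∫⁻ y, Ψ y b ^ 2 ∂μ) ^ (1 / 2 : ℝ) ∂ν := by
  refine lintegral_mono fun b => ?_
  have hΨb : Measurable fun y => Ψ y b := hΨ.comp (measurable_id.prodMk measurable_const)
  rw [sq]
  gcongr
  exact lintegral_mul_le_sqrt μ hφ.aemeasurable hΨb.aemeasurable hφ1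

/-- **The sandwich, normalised form.** For `Ψ ≥ 0` with `∫∫ Ψ² d(μ⊗ν) = 1` (an `N`-body
probability amplitude) and a mode `φ ≥ 0` with `∫ φ² dμ ≤ 1`:
`BC² ≤ f ≤ BC`, where `f = ∫_b (∫ φ Ψ(·,b) dμ)² dν` is the weight of the mode and
`BC = ∫_b (∫ φ Ψ(·,b) dμ) (∫ Ψ(·,b)² dμ)^{1/2} dν` its Bhattacharyya coefficient. In particular
`f` is bounded below uniformly (condensation in the mode `φ`) iff `BC` is. -/
theorem bhattacharyya_sandwich [SFinite μ] {Ψ : α → β → ℝ≥0∞} {φ : α → ℝ≥0∞}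
    (hΨ : Measurable (Function.uncurry Ψ)) (hφ : Measurable φ) (hφ1 : ∫⁻ y, φ y ^ 2 ∂μ ≤ 1)
    (hΨ1 : ∫⁻ b, ∫⁻ y, Ψ y b ^ 2 ∂μ ∂ν = 1) :
    (∫⁻ b, (∫⁻ y, φ y * Ψ y b ∂μ) * (∫⁻ y, Ψ y b ^ 2 ∂μ) ^ (1 / 2 : ℝ) ∂ν) ^ 2 ≤
        ∫⁻ b, (∫⁻ y, φ y * Ψ y b ∂μ) ^ 2 ∂ν ∧
      ∫⁻ b, (∫⁻ y, φ y * Ψ y b ∂μ) ^ 2 ∂ν ≤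
        ∫⁻ b, (∫⁻ y, φ y * Ψ y b ∂μ) * (∫⁻ y, Ψ y b ^ 2 ∂μ) ^ (1 / 2 : ℝ) ∂ν := by
  refine ⟨?_, modeWeight_le_bhattacharyya μ ν hΨ hφ hφ1⟩
  simpa [hΨ1] using bhattacharyya_sq_le_modeWeight_mul μ ν hΨ hφ

/-- **Identification of `BC` with the Bhattacharyya coefficient on the product space**
(Tonelli): `∫ √(φ(y)² · P̂(b) · Ψ(y,b)²) d(μ⊗ν)(y,b) = ∫_b m(b) P̂(b)^{1/2} dν`, i.e. the
quantity bounded above is literally `∫ √(dQ · dP)` for `P = Ψ²(μ⊗ν)` and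
`Q = (φ²μ) ⊗ (P̂ν)`, both written as densities against `μ ⊗ ν`. -/
theorem lintegral_sqrt_densities_eq [SFinite μ] [SFinite ν] {Ψ : α → β → ℝ≥0∞} {φ : α → ℝ≥0∞}
    (hΨ : Measurable (Function.uncurry Ψ)) (hφ : Measurable φ) :
    ∫⁻ p, (φ p.1 ^ 2 * (∫⁻ y, Ψ y p.2 ^ 2 ∂μ) * Ψ p.1 p.2 ^ 2) ^ (1 / 2 : ℝ) ∂(μ.prod ν) =
      ∫⁻ b, (∫⁻ y, φ y * Ψ y b ∂μ) * (∫⁻ y, Ψ y b ^ 2 ∂μ) ^ (1 / 2 : ℝ) ∂ν := by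
  have hP : Measurable fun b => ∫⁻ y, Ψ y b ^ 2 ∂μ := by
    have : Measurable fun p : α × β => Ψ p.1 p.2 ^ 2 := hΨ.pow_const 2
    exact this.lintegral_prod_left'
  have hF : Measurable fun p : α × β =>
      (φ p.1 ^ 2 * (∫⁻ y, Ψ y p.2 ^ 2 ∂μ) * Ψ p.1 p.2 ^ 2) ^ (1 / 2 : ℝ) :=
    ((((hφ.comp measurable_fst).pow_const 2).mul (hP.comp measurable_snd)).mul
      (hΨ.pow_const 2)).pow_const _
  rw [lintegral_prod_symm _ hF.aemeasurable]
  refine lintegral_congr fun b => ?_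
  have hpt : ∀ y, (φ y ^ 2 * (∫⁻ y, Ψ y b ^ 2 ∂μ) * Ψ y b ^ 2) ^ (1 / 2 : ℝ) =
      φ y * Ψ y b * (∫⁻ y, Ψ y b ^ 2 ∂μ) ^ (1 / 2 : ℝ) := by
    intro y
    have h2 : ∀ x : ℝ≥0∞, (x ^ 2) ^ (1 / 2 : ℝ) = x := by
      intro x; rw [← ENNReal.rpow_two, ← ENNReal.rpow_mul]; norm_num
    rw [mul_right_comm, ENNReal.mul_rpow_of_nonneg _ _ (by norm_num : (0 : ℝ) ≤ 1 / 2),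
      ENNReal.mul_rpow_of_nonneg _ _ (by norm_num : (0 : ℝ) ≤ 1 / 2), h2, h2]
  simp_rw [hpt]
  have hΨb : Measurable fun y => Ψ y b := hΨ.comp (measurable_id.prodMk measurable_const)
  have hφΨ : Measurable fun y => φ y * Ψ y b := hφ.mul hΨb
  rw [lintegral_mul_const _ hφΨ]

/-! ### Specialisation to the Bose-gas occupation functional

For a **nonnegative real** trial function `Φ` on `Config (n+1)` and a nonnegative real mode `g`,
the occupation `⟨g, γ_Φ g⟩ = occupation (n+1) g Φ` of
`Literature.MathematicalPhysics.QuantumManyBody.BoseGas` is `(n+1) ∫_Y (∫_x g(x) Φ(x :: Y))²`,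
so the abstract sandwich applies with `μ = ν = volume`, `Ψ x Y = Φ (x :: Y)`:
`(n+1) · BC² ≤ occupation (n+1) g Φ ≤ (n+1) · BC`.  Ground states of `H_N` with `v ≥ 0` are
nonnegative, so this is the form in which the affinity criterion enters the conjunct. -/

section BoseGas

open Literature.MathematicalPhysics.QuantumManyBody.BoseGas

/-- Joint measurability of `(x, Y) ↦ x :: Y`. -/
theorem measurable_vecCons {n : ℕ} :
    Measurable fun p : Space × Config n => (Matrix.vecCons p.1 p.2 : Config (n + 1)) := by
  refine measurable_pi_lambda _ fun i => ?_
  refine Fin.cases ?_ (fun j => ?_) i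
  · simp only [Matrix.cons_val_zero]
    exact measurable_fst
  · simp only [Matrix.cons_val_succ]
    exact (measurable_pi_apply j).comp measurable_snd

/-- For `r ≥ 0`, the extended norm of `(r : ℂ)` is `ENNReal.ofReal r`. -/
theorem coe_nnnorm_ofReal_of_nonneg {r : ℝ} (hr : 0 ≤ r) :
    ((‖(r : ℂ)‖₊ : NNReal) : ℝ≥0∞) = ENNReal.ofReal r := by
  rw [Complex.nnnorm_real, Real.nnnorm_of_nonneg hr, ENNReal.ofReal_eq_coe_nnreal hr]

/-- The occupation of a nonnegative real mode in a nonnegative real trial function, as a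
Lebesgue integral: `occupation (n+1) g Φ = (n+1) ∫_Y (∫_x g x · Φ (x :: Y))²`. -/
theorem occupation_ofReal_eq {n : ℕ} {g : Space → ℝ} {Φ : Config (n + 1) → ℝ}
    (hg0 : 0 ≤ g) (hΦ0 : 0 ≤ Φ)
    (hint : ∀ Y : Config n, Integrable (fun x => g x * Φ (Matrix.vecCons x Y))) :
    occupation (n + 1) (fun x => (g x : ℂ)) (fun X => (Φ X : ℂ)) =
      (n + 1 : ℝ≥0∞) * ∫⁻ Y : Config n,
        (∫⁻ x, ENNReal.ofReal (g x) * ENNReal.ofReal (Φ (Matrix.vecCons x Y))) ^ 2 := by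
  simp only [occupation]
  congr 1
  refine lintegral_congr fun Y => ?_
  have hr : 0 ≤ ∫ x, g x * Φ (Matrix.vecCons x Y) :=
    integral_nonneg fun x => mul_nonneg (hg0 x) (hΦ0 _)
  have h1 : ∫ x, (starRingEnd ℂ) ((g x : ℂ)) * ((Φ (Matrix.vecCons x Y) : ℝ) : ℂ) =
      ((∫ x, g x * Φ (Matrix.vecCons x Y) : ℝ) : ℂ) := by
    have hfun : (fun x => (starRingEnd ℂ) ((g x : ℂ)) * ((Φ (Matrix.vecCons x Y) : ℝ) : ℂ)) =
        fun x => ((g x * Φ (Matrix.vecCons x Y) : ℝ) : ℂ) := by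
      ext x
      simp only [Complex.conj_ofReal, Complex.ofReal_mul]
    rw [hfun]
    exact integral_complex_ofReal
  rw [h1, coe_nnnorm_ofReal_of_nonneg hr,
    ofReal_integral_eq_lintegral_ofReal (hint Y)
      (ae_of_all _ fun x => mul_nonneg (hg0 x) (hΦ0 _))]
  congr 1
  refine lintegral_congr fun x => ?_
  rw [ENNReal.ofReal_mul (hg0 x)]

/-- **Affinity sandwich for the occupation** of a nonnegative real mode `g` (`∫ g² ≤ 1`) in a
nonnegative real `(n+1)`-particle trial function `Φ` normalised in the iterated form
`∫_Y ∫_x Φ(x :: Y)² = 1`: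
`(n+1) BC² ≤ occupation (n+1) g Φ ≤ (n+1) BC` with
`BC = ∫_Y (∫_x g x Φ(x :: Y)) (∫_x Φ(x :: Y)²)^{1/2}` the Bhattacharyya coefficient of `Φ²`
against its one-particle resampling `g² ⊗ P̂`. -/
theorem occupation_bhattacharyya_sandwich {n : ℕ} {g : Space → ℝ} {Φ : Config (n + 1) → ℝ}
    (hg0 : 0 ≤ g) (hΦ0 : 0 ≤ Φ) (hgm : Measurable g) (hΦm : Measurable Φ)
    (hint : ∀ Y : Config n, Integrable (fun x => g x * Φ (Matrix.vecCons x Y)))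
    (hg1 : ∫⁻ x, ENNReal.ofReal (g x) ^ 2 ≤ 1)
    (hΦ1 : ∫⁻ Y : Config n, ∫⁻ x, ENNReal.ofReal (Φ (Matrix.vecCons x Y)) ^ 2 = 1) :
    (n + 1 : ℝ≥0∞) *
        (∫⁻ Y : Config n, (∫⁻ x, ENNReal.ofReal (g x) * ENNReal.ofReal (Φ (Matrix.vecCons x Y))) *
          (∫⁻ x, ENNReal.ofReal (Φ (Matrix.vecCons x Y)) ^ 2) ^ (1 / 2 : ℝ)) ^ 2 ≤
        occupation (n + 1) (fun x => (g x : ℂ)) (fun X => (Φ X : ℂ)) ∧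
      occupation (n + 1) (fun x => (g x : ℂ)) (fun X => (Φ X : ℂ)) ≤
        (n + 1 : ℝ≥0∞) *
          ∫⁻ Y : Config n, (∫⁻ x, ENNReal.ofReal (g x) * ENNReal.ofReal (Φ (Matrix.vecCons x Y))) *
            (∫⁻ x, ENNReal.ofReal (Φ (Matrix.vecCons x Y)) ^ 2) ^ (1 / 2 : ℝ) := by
  have hΨ : Measurable (Function.uncurry fun (x : Space) (Y : Config n) =>
      ENNReal.ofReal (Φ (Matrix.vecCons x Y))) :=
    ENNReal.measurable_ofReal.comp (hΦm.comp measurable_vecCons)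
  have hφ : Measurable fun x => ENNReal.ofReal (g x) := ENNReal.measurable_ofReal.comp hgm
  have h := bhattacharyya_sandwich (volume : Measure Space) (volume : Measure (Config n))
    hΨ hφ hg1 hΦ1
  rw [occupation_ofReal_eq hg0 hΦ0 hint]
  exact ⟨mul_le_mul' le_rfl h.1, mul_le_mul' le_rfl h.2⟩

/-- **Affinity lower bound for `λ_max(γ_Φ)`.** With `g` moreover square-normalised
(`∫ g² = 1`), `(n+1) · BC² ≤ maxOccupation (n+1) Φ`: a nonnegative trial function whose
Bhattacharyya affinity to its one-particle resampling is `≥ c` has a mode occupied by at least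
`c² (n+1)` particles. -/
theorem bhattacharyya_sq_le_maxOccupation {n : ℕ} {g : Space → ℝ} {Φ : Config (n + 1) → ℝ}
    (hg0 : 0 ≤ g) (hΦ0 : 0 ≤ Φ) (hgm : Measurable g) (hΦm : Measurable Φ)
    (hint : ∀ Y : Config n, Integrable (fun x => g x * Φ (Matrix.vecCons x Y)))
    (hg1 : ∫⁻ x, ENNReal.ofReal (g x) ^ 2 = 1)
    (hΦ1 : ∫⁻ Y : Config n, ∫⁻ x, ENNReal.ofReal (Φ (Matrix.vecCons x Y)) ^ 2 = 1) :
    (n + 1 : ℝ≥0∞) *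
        (∫⁻ Y : Config n, (∫⁻ x, ENNReal.ofReal (g x) * ENNReal.ofReal (Φ (Matrix.vecCons x Y))) *
          (∫⁻ x, ENNReal.ofReal (Φ (Matrix.vecCons x Y)) ^ 2) ^ (1 / 2 : ℝ)) ^ 2 ≤
      maxOccupation (n + 1) (fun X => (Φ X : ℂ)) := by
  refine (occupation_bhattacharyya_sandwich hg0 hΦ0 hgm hΦm hint hg1.le hΦ1).1.trans ?_
  refine occupation_le_maxOccupation _ ?_ ?_
  · exact (Complex.measurable_ofReal.comp hgm).aestronglyMeasurable
  · rw [← hg1]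
    refine lintegral_congr fun x => ?_
    rw [coe_nnnorm_ofReal_of_nonneg (hg0 x)]

end BoseGas

end Summit.AtomisticToContinuum.BoseEinsteinCondensation.Theorems
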